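import Summits.KontsevichZagierPeriods.KontsevichZagierPeriods.Theorems.SymplecticScissorsRealOnePeriodRelationsLogLoopLayer
import Summits.KontsevichZagierPeriods.KontsevichZagierPeriods.Theorems.SymplecticScissorsRealOnePeriodRelationsLoopLayerModels

/-!
# Crux `RealOnePeriodRelations` (stmt-KontsevichZagierPeriods-10042) — the log–loop layer for general real cubic models

Line `nash-retraction-thin-strip`, continuation c4 (reshape 6), corollary of `LogLoopLayer.realOnePeriodRelations_ratLoopLayer`:
rational representations (`π`, logarithms of rationals, …) together with complete real elliptic integrals on any finite family of
general real monic cubics `y² = x³ + a₂x² + a₁x + a₀` over `ℚ̄ ∩ ℝ` (the Legendre cubic `x(x − 1)(x − λ)` included), by one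
rule-2 translation per cell (`LoopLayer.shift_oval_cell`, `LoopLayer.shift_branch_cell`).
[cite: HuberWustholz2022, Thm 13.3 (2), Thm 15.3 (1), Rem. 15.11] [cite: KontsevichZagier2001, §1.2]
-/

noncomputable section

open scoped BigOperators Polynomial
open Set MeasureTheory MvPolynomial
open Literature.NumberTheory.Transcendental Literature.NumberTheory.Transcendental.CurvePeriods
open Summit.KontsevichZagierPeriods.SymplecticScissors.RealOnePeriodRelationsNegative (M₁ H₁ crux_iff unitDom)

namespace Summit.KontsevichZagierPeriods.SymplecticScissors.RealOnePeriodRelations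

namespace LogLoopLayer

/-- **THE LOG–LOOP LAYER FOR GENERAL REAL MONIC CUBICS** `F_j = x³ + a₂x² + a₁x + a₀` over `ℚ̄ ∩ ℝ` (the Legendre cubic
`x(x − 1)(x − λ)` and every real model included), UNCONDITIONALLY, WITH THE RATIONAL REPRESENTATIONS: for any finite family, with the
lattices of the depressed forms, every `ℤ`-combination with vanishing value of rational representations (`π`, logarithms of
rationals, …), polynomial cells, complete integrals `∫_{ε₁}^{ε₂} (P₁ + P₂√F_j + P₃/√F_j)`
over real ovals (consecutive real roots) and `∫_ε^∞ c₀/√F_j` over real branches (largest real root) lies in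
`M₁ = closure (1a ∪ 1b ∪ 2 ∪ Green)` — by one rule-2 translation per cell (`shift_oval_cell`, `shift_branch_cell`) and
`LogLoopLayer.realOnePeriodRelations_ratLoopLayer`. [cite: HuberWustholz2022, Thm 13.3 (2), Thm 15.3] [cite: KontsevichZagier2001, §1.2] -/
theorem realOnePeriodRelations_ratCubicLayer : ∀ (n : ℕ) (a₂ a₁ a₀ : Fin n → ℝ), (∀ j, IsAlgebraic ℚ (a₂ j)) →
    (∀ j, IsAlgebraic ℚ (a₁ j)) → (∀ j, IsAlgebraic ℚ (a₀ j)) → ∀ (L : Fin n → PeriodPair),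
    (∀ j, (L j).g₂ = -4 * ((a₁ j - a₂ j ^ 2 / 3 : ℝ) : ℂ)) →
    (∀ j, (L j).g₃ = -4 * ((a₀ j - a₁ j * a₂ j / 3 + 2 * a₂ j ^ 3 / 27 : ℝ) : ℂ)) →
    ∀ c : KZ.FormalRep, c ∈ AddSubgroup.closure ((fun r : KZ.IntegralRep 1 => KZ.of r) ''
      {r | r.IsRational ∨ (∃ a b : ℝ, IsAlgebraic ℚ a ∧ IsAlgebraic ℚ b ∧ a < b ∧ r.domain = {z | z 0 ∈ Set.Ioo a b} ∧
            ∃ P : Polynomial (algebraicClosure ℚ ℝ), ∀ x ∈ Set.Ioo a b, r.integrand (fun _ => x) = Polynomial.aeval x P) ∨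
        (∃ j, ∃ ε₁ ε₂ : ℝ, IsAlgebraic ℚ ε₁ ∧ IsAlgebraic ℚ ε₂ ∧ ε₁ < ε₂ ∧
          ε₁ ^ 3 + a₂ j * ε₁ ^ 2 + a₁ j * ε₁ + a₀ j = 0 ∧ ε₂ ^ 3 + a₂ j * ε₂ ^ 2 + a₁ j * ε₂ + a₀ j = 0 ∧
          (∀ x ∈ Set.Ioo ε₁ ε₂, 0 < x ^ 3 + a₂ j * x ^ 2 + a₁ j * x + a₀ j) ∧ r.domain = {z | z 0 ∈ Set.Ioo ε₁ ε₂} ∧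
          ∃ P₁ P₂ P₃ : Polynomial (algebraicClosure ℚ ℝ), ∀ x ∈ Set.Ioo ε₁ ε₂,
            r.integrand (fun _ => x) = Polynomial.aeval x P₁ +
              Polynomial.aeval x P₂ * Real.sqrt (x ^ 3 + a₂ j * x ^ 2 + a₁ j * x + a₀ j) +
              Polynomial.aeval x P₃ / Real.sqrt (x ^ 3 + a₂ j * x ^ 2 + a₁ j * x + a₀ j)) ∨
        (∃ j, ∃ ε c₀ : ℝ, IsAlgebraic ℚ ε ∧ IsAlgebraic ℚ c₀ ∧ ε ^ 3 + a₂ j * ε ^ 2 + a₁ j * ε + a₀ j = 0 ∧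
          (∀ x : ℝ, ε < x → 0 < x ^ 3 + a₂ j * x ^ 2 + a₁ j * x + a₀ j) ∧ r.domain = {z | ε < z 0} ∧
          ∀ z ∈ r.domain, r.integrand z = c₀ / Real.sqrt ((z 0) ^ 3 + a₂ j * (z 0) ^ 2 + a₁ j * (z 0) + a₀ j))}) →
    KZ.eval c = 0 →
    c ∈ AddSubgroup.closure (KZ.domainAddRel ∪ KZ.integrandAddRel ∪ KZ.changeOfVariablesRel ∪
      {g : KZ.FormalRep | ∃ (Δ : Set (Fin 2 → ℝ)) (A B S : (Fin 2 → ℝ) → ℝ) (r₀₁ r₁₂ r₀₂ : KZ.IntegralRep 1),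
        Δ = {p | 0 ≤ p 0 ∧ 0 ≤ p 1 ∧ p 0 + p 1 ≤ 1} ∧ IsSemialgebraicFunOn ℚ Δ A ∧ IsSemialgebraicFunOn ℚ Δ B ∧
        ContinuousOn A Δ ∧ ContinuousOn B Δ ∧
        (∀ p : Fin 2 → ℝ, 0 < p 0 → 0 < p 1 → p 0 + p 1 < 1 →
          HasFDerivAt S (A p • ContinuousLinearMap.proj (R := ℝ) (φ := fun _ : Fin 2 => ℝ) 0 +
            B p • ContinuousLinearMap.proj (R := ℝ) (φ := fun _ : Fin 2 => ℝ) 1) p) ∧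
        r₀₁.domain = {z | z 0 ∈ Set.Ioo 0 1} ∧ r₁₂.domain = {z | z 0 ∈ Set.Ioo 0 1} ∧
        r₀₂.domain = {z | z 0 ∈ Set.Ioo 0 1} ∧ (∀ z ∈ r₀₁.domain, r₀₁.integrand z = A ![z 0, 0]) ∧
        (∀ z ∈ r₁₂.domain, r₁₂.integrand z = B ![1 - z 0, z 0] - A ![1 - z 0, z 0]) ∧
        (∀ z ∈ r₀₂.domain, r₀₂.integrand z = B ![0, z 0]) ∧ g = KZ.of r₀₁ + KZ.of r₁₂ - KZ.of r₀₂}) := by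
  intro n a₂ a₁ a₀ ha₂ ha₁ ha₀ L hL₂ hL₃ c hc heval
  change c ∈ M₁
  set A : Fin n → ℝ := fun j => a₁ j - a₂ j ^ 2 / 3 with hA
  set B : Fin n → ℝ := fun j => a₀ j - a₁ j * a₂ j / 3 + 2 * a₂ j ^ 3 / 27 with hB
  have h3 : IsAlgebraic ℚ (3 : ℝ)⁻¹ := (isAlgebraic_nat 3).inv
  have h27 : IsAlgebraic ℚ (27 : ℝ)⁻¹ := (isAlgebraic_nat 27).inv
  have hAalg : ∀ j, IsAlgebraic ℚ (A j) := fun j => by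
    simp only [hA, div_eq_mul_inv]
    exact (ha₁ j).sub (((ha₂ j).pow 2).mul h3)
  have hBalg : ∀ j, IsAlgebraic ℚ (B j) := fun j => by
    simp only [hB, div_eq_mul_inv]
    exact ((ha₀ j).sub (((ha₁ j).mul (ha₂ j)).mul h3)).add (((isAlgebraic_nat 2).mul ((ha₂ j).pow 3)).mul h27)
  have key : ∀ c : KZ.FormalRep, c ∈ AddSubgroup.closure ((fun r : KZ.IntegralRep 1 => KZ.of r) ''
      {r | r.IsRational ∨ (∃ a b : ℝ, IsAlgebraic ℚ a ∧ IsAlgebraic ℚ b ∧ a < b ∧ r.domain = {z | z 0 ∈ Set.Ioo a b} ∧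
            ∃ P : Polynomial (algebraicClosure ℚ ℝ), ∀ x ∈ Set.Ioo a b, r.integrand (fun _ => x) = Polynomial.aeval x P) ∨
        (∃ j, ∃ ε₁ ε₂ : ℝ, IsAlgebraic ℚ ε₁ ∧ IsAlgebraic ℚ ε₂ ∧ ε₁ < ε₂ ∧
          ε₁ ^ 3 + a₂ j * ε₁ ^ 2 + a₁ j * ε₁ + a₀ j = 0 ∧ ε₂ ^ 3 + a₂ j * ε₂ ^ 2 + a₁ j * ε₂ + a₀ j = 0 ∧
          (∀ x ∈ Set.Ioo ε₁ ε₂, 0 < x ^ 3 + a₂ j * x ^ 2 + a₁ j * x + a₀ j) ∧ r.domain = {z | z 0 ∈ Set.Ioo ε₁ ε₂} ∧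
          ∃ P₁ P₂ P₃ : Polynomial (algebraicClosure ℚ ℝ), ∀ x ∈ Set.Ioo ε₁ ε₂,
            r.integrand (fun _ => x) = Polynomial.aeval x P₁ +
              Polynomial.aeval x P₂ * Real.sqrt (x ^ 3 + a₂ j * x ^ 2 + a₁ j * x + a₀ j) +
              Polynomial.aeval x P₃ / Real.sqrt (x ^ 3 + a₂ j * x ^ 2 + a₁ j * x + a₀ j)) ∨
        (∃ j, ∃ ε c₀ : ℝ, IsAlgebraic ℚ ε ∧ IsAlgebraic ℚ c₀ ∧ ε ^ 3 + a₂ j * ε ^ 2 + a₁ j * ε + a₀ j = 0 ∧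
          (∀ x : ℝ, ε < x → 0 < x ^ 3 + a₂ j * x ^ 2 + a₁ j * x + a₀ j) ∧ r.domain = {z | ε < z 0} ∧
          ∀ z ∈ r.domain, r.integrand z = c₀ / Real.sqrt ((z 0) ^ 3 + a₂ j * (z 0) ^ 2 + a₁ j * (z 0) + a₀ j))}) →
      ∃ c' : KZ.FormalRep, c' ∈ AddSubgroup.closure ((fun r : KZ.IntegralRep 1 => KZ.of r) ''
      {r | r.IsRational ∨ (∃ a b : ℝ, IsAlgebraic ℚ a ∧ IsAlgebraic ℚ b ∧ a < b ∧ r.domain = {z | z 0 ∈ Set.Ioo a b} ∧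
            ∃ P : Polynomial (algebraicClosure ℚ ℝ), ∀ x ∈ Set.Ioo a b, r.integrand (fun _ => x) = Polynomial.aeval x P) ∨
        (∃ j, ∃ e₁ e₂ : ℝ, IsAlgebraic ℚ e₁ ∧ IsAlgebraic ℚ e₂ ∧ e₁ < e₂ ∧ e₁ ^ 3 + A j * e₁ + B j = 0 ∧
          e₂ ^ 3 + A j * e₂ + B j = 0 ∧ (∀ x ∈ Set.Ioo e₁ e₂, 0 < x ^ 3 + A j * x + B j) ∧
          r.domain = {z | z 0 ∈ Set.Ioo e₁ e₂} ∧
          ∃ P₁ P₂ P₃ : Polynomial (algebraicClosure ℚ ℝ), ∀ x ∈ Set.Ioo e₁ e₂,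
            r.integrand (fun _ => x) = Polynomial.aeval x P₁ + Polynomial.aeval x P₂ * Real.sqrt (x ^ 3 + A j * x + B j) +
              Polynomial.aeval x P₃ / Real.sqrt (x ^ 3 + A j * x + B j)) ∨
        (∃ j, ∃ e c₀ : ℝ, IsAlgebraic ℚ e ∧ IsAlgebraic ℚ c₀ ∧ e ^ 3 + A j * e + B j = 0 ∧
          (∀ x : ℝ, e < x → 0 < x ^ 3 + A j * x + B j) ∧ r.domain = {z | e < z 0} ∧
          ∀ z ∈ r.domain, r.integrand z = c₀ / Real.sqrt ((z 0) ^ 3 + A j * (z 0) + B j))}) ∧ c - c' ∈ M₁ := by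
    intro c hc
    refine AddSubgroup.closure_induction (p := fun c _ => ∃ c' : KZ.FormalRep, c' ∈ _ ∧ c - c' ∈ M₁) ?_ ?_ ?_ ?_ hc
    · rintro _ ⟨r, hr, rfl⟩
      rcases hr with hrat | hpoly | ⟨j, ε₁, ε₂, hε₁, hε₂, hlt, hF₁, hF₂, hpos, hdom, P₁, P₂, P₃, hint⟩ |
        ⟨j, ε, c₀, hε, hc₀, hF, hpos, hdom, hint⟩
      · exact ⟨KZ.of r, AddSubgroup.subset_closure ⟨r, Or.inl hrat, rfl⟩, by rw [sub_self]; exact M₁.zero_mem⟩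
      · exact ⟨KZ.of r, AddSubgroup.subset_closure ⟨r, Or.inr (Or.inl hpoly), rfl⟩, by rw [sub_self]; exact M₁.zero_mem⟩
      · obtain ⟨ρ, hρ, hrel⟩ := LoopLayer.shift_oval_cell (a₂ j) (a₁ j) (a₀ j) (ha₂ j) (ha₁ j) (ha₀ j) hε₁ hε₂ hlt hF₁ hF₂ hpos
          P₁ P₂ P₃ r hdom hint
        exact ⟨KZ.of ρ, AddSubgroup.subset_closure ⟨ρ, Or.inr (Or.inr (Or.inl ⟨j, hρ⟩)), rfl⟩, hrel⟩
      · obtain ⟨ρ, hρ, hrel⟩ := LoopLayer.shift_branch_cell (a₂ j) (a₁ j) (a₀ j) (ha₂ j) (ha₁ j) (ha₀ j) hε hc₀ hF hpos r hdom hint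
        exact ⟨KZ.of ρ, AddSubgroup.subset_closure ⟨ρ, Or.inr (Or.inr (Or.inr ⟨j, hρ⟩)), rfl⟩, hrel⟩
    · exact ⟨0, AddSubgroup.zero_mem _, by rw [sub_self]; exact M₁.zero_mem⟩
    · rintro c₁ c₂ _ _ ⟨c₁', h₁', h₁⟩ ⟨c₂', h₂', h₂⟩
      refine ⟨c₁' + c₂', AddSubgroup.add_mem _ h₁' h₂', ?_⟩
      have e : c₁ + c₂ - (c₁' + c₂') = (c₁ - c₁') + (c₂ - c₂') := by abel
      rw [e]
      exact M₁.add_mem h₁ h₂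
    · rintro c₁ _ ⟨c₁', h₁', h₁⟩
      refine ⟨-c₁', AddSubgroup.neg_mem _ h₁', ?_⟩
      have e : -c₁ - -c₁' = -(c₁ - c₁') := by abel
      rw [e]
      exact M₁.neg_mem h₁
  obtain ⟨c', hc', hcc'⟩ := key c hc
  have heval' : KZ.eval c' = 0 := by
    have h := Summit.KontsevichZagierPeriods.SymplecticScissors.RealOnePeriodRelationsNegative.eval_eq_zero_of_mem_M₁ hcc'
    rw [map_sub, heval, zero_sub, neg_eq_zero] at h
    exact h
  have hM : c' ∈ M₁ :=
    realOnePeriodRelations_ratLoopLayer n A B hAalg hBalg L (fun j => by rw [hL₂ j]) (fun j => by rw [hL₃ j])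
      c' hc' heval'
  have e : c = (c - c') + c' := by abel
  rw [e]
  exact M₁.add_mem hcc' hM

end LogLoopLayer

end Summit.KontsevichZagierPeriods.SymplecticScissors.RealOnePeriodRelations

end
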